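import Mathlib
import HarnessLib
import Summits.QuantumFields.YangMills.Theorems.HypercubicLimit.Negative.ReflectedDensity
import Summits.QuantumFields.YangMills.Theorems.FradkinShenkerFlowFiniteSusceptibilityWeakCouplingRPCauchySchwarz
import Literature.MathematicalPhysics.AQFT.OSAxiomsSchwinger
import Literature.MathematicalPhysics.QuantumLattice.LatticeScalarField
import Literature.MathematicalPhysics.QuantumFieldTheory.LatticeGaugeStaticPotentialProofs
import Literature.Probability.LatticeModels.ThermodynamicLimit

/-!
# Block M-π of line `conditional-mean-telescoping` (crux stmt-QuantumFields-8646): moment identity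
under coordinate permutations

The centred torus moment of a plaquette string `(q k, x k, m k)` for Wilson's lattice gauge measure
on the torus of side `2L+1` is invariant under a simultaneous permutation `π` of the four coordinate
axes: orientation `(i, j) ↦ (π i, π j)`, corner `x ↦ π·x` with `(π·x) i = x (π⁻¹ i)`.

Proof: Wilson's torus measure is invariant under the measurable equivalence `configPerm π` (tree,
`wilsonMeasure_map_configPerm`), and the plaquette of orientation `(π i, π j)` at the permuted
corner `π·y` of the permuted configuration `configPerm π U` is the plaquette `(i, j)` at `y` of `U`
(`plaquetteHolonomy_configPerm` + the bridge `plaquetteHolonomyZd_torusLift'`); change variables.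
-/

noncomputable section

open scoped SchwartzMap ComplexConjugate
open MeasureTheory
open Literature.MathematicalPhysics.AQFT Literature.MathematicalPhysics.QuantumLattice
open Literature.MathematicalPhysics.QuantumFieldTheory
open Literature.Probability.LatticeModels (box Site)
open Summit.QuantumFields.YangMills.Theorems.HypercubicLimit.Negative (torusPlaquette thetaZ)

namespace Summit.QuantumFields.YangMills.Cruxes.HypercubicLimit.ConditionalMeanTelescoping

/-- (auxiliary, block M-π) Projecting the permuted `ℤ⁴`-corner `π·y` to the torus and undoing the
permutation of the torus site gives the projection of `y`. [folklore] -/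
theorem mPerm_sitePerm_symm_proj (S : ℕ) (π : Equiv.Perm (Fin 4)) (y : Fin 4 → ℤ) :
    sitePerm π.symm (Literature.Probability.LatticeModels.Torus.proj S (fun l => y (π.symm l))) =
      Literature.Probability.LatticeModels.Torus.proj S y := by
  funext l
  simp [Literature.Probability.LatticeModels.Torus.proj, sitePerm_apply]

/-- (auxiliary, block M-π) The torus plaquette of orientation `(π i, π j)` at the permuted corner
`π·y` of the permuted configuration `configPerm π U` is the plaquette `(i, j)` at `y` of `U`.
[folklore] -/
theorem mPerm_torusPlaquette_configPerm {G : Type} [Group G] [TopologicalSpace G]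
    [MeasurableSpace G] (r : LatticeRep G) (S : ℕ) (π : Equiv.Perm (Fin 4)) (i j : Fin 4)
    (y : Fin 4 → ℤ) (U : GaugeConfig 4 S G) :
    torusPlaquette r S (π i) (π j) (fun l => y (π.symm l)) (configPerm π U) =
      torusPlaquette r S i j y U := by
  unfold torusPlaquette plaquetteObs
  rw [Theorems.CurvatureBoostCovariance.Negative.plaquetteHolonomyZd_torusLift',
    Theorems.CurvatureBoostCovariance.Negative.plaquetteHolonomyZd_torusLift',
    plaquetteHolonomy_configPerm, mPerm_sitePerm_symm_proj, Equiv.symm_apply_apply,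
    Equiv.symm_apply_apply]

/-- **Block M-π (moment identity under coordinate permutations).** The centred torus moment of a
plaquette string is invariant under a simultaneous permutation `π` of the coordinate axes: orientation
`(i, j) ↦ (π i, π j)`, corner `x ↦ π·x` with `(π·x) i = x (π⁻¹ i)` (tree `configPerm`, `sitePerm`,
`wilsonMeasure_map_configPerm`). [folklore] -/
theorem rpBlock_momentPerm :
    ∀ (G : Type) [Group G] [TopologicalSpace G] [IsTopologicalGroup G] [CompactSpace G]
      [MeasurableSpace G] [BorelSpace G] (r : LatticeRep G) (β : ℝ) (L n : ℕ)
      (π : Equiv.Perm (Fin 4)) (q : Fin n → Fin 4 × Fin 4) (m : Fin n → ℝ) (x : Fin n → (Fin 4 → ℤ)),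
        (∫ U, ∏ k, (torusPlaquette r (2 * L + 1) (q k).1 (q k).2 (x k) U - m k)
            ∂(wilsonMeasure r.ρ β : Measure (GaugeConfig 4 (2 * L + 1) G))) =
          ∫ U, ∏ k, (torusPlaquette r (2 * L + 1) (π (q k).1) (π (q k).2)
              (fun i => x k (π.symm i)) U - m k)
            ∂(wilsonMeasure r.ρ β : Measure (GaugeConfig 4 (2 * L + 1) G)) := by
  intro G _ _ _ _ _ _ r β L n π q m x
  haveI : NeZero (2 * L + 1) := ⟨by omega⟩
  have h := integral_map_equiv (μ := (wilsonMeasure r.ρ β : Measure (GaugeConfig 4 (2 * L + 1) G)))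
    (configPerm π) (fun U => ∏ k, (torusPlaquette r (2 * L + 1) (π (q k).1) (π (q k).2)
      (fun i => x k (π.symm i)) U - m k))
  rw [wilsonMeasure_map_configPerm r.ρ r.continuous β π] at h
  rw [h]
  simp only [mPerm_torusPlaquette_configPerm]

end Summit.QuantumFields.YangMills.Cruxes.HypercubicLimit.ConditionalMeanTelescoping

end
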